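import Mathlib
import HarnessLib
import Summits.HubbardSuperconductivity.HubbardSuperconductivity.Theorems.KLProgrammeKLRegimeCountertermJacksonSharpMoments
import Summits.HubbardSuperconductivity.HubbardSuperconductivity.Theorems.KLProgrammeKLRegimeCountertermJacksonRemainderScaleLaw

/-!
# (C1) JACKSON REMAINDER AT DEEP SCALES — the TRANSPORT MOMENT of the 2-D Jackson weight («(C)-JETBOX-DEEP», the constant `κ`)

Cell `gate-hubbard-kl`, seat hubbard-kl-k3c3-p3 (g11), `--supports stmt-HubbardSuperconductivity-20437` (stub (C) of `KLRegimeEngineV17F2`).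
Memo `HOME/hubbard-kl-k3c3-p3/C1-JETBOX-DEEP.md` §3; companion `…CountertermJacksonRemainderScaleLaw` (the `n`-bookkeeping).

The deep-scale floor of the (C1) door is its TRANSPORT RATE row `a_{k+1}(n)·Td`, `Td = ∫ J̃_dJ̃_d·χ_w·|⟨α_w(θ) − θ⟩| dμ(w)` with
`|⟨α_w(θ) − θ⟩| ≈ |w_⊥(θ)|/u(θ)`, `w_⊥(θ) = −s·sin θ + t·cos θ` the component of the momentum displacement `w = (s,t)` normal to the radial direction.
This file proves the kernel half, SHARP and uniform in the direction: for every `a, b`,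

  `∫ J̃_d(s)J̃_d(t)·|a·s + b·t| dμ ≤ √(a² + b²)·π√3/(2(d+1))`   (`integral_jweight_mul_abs_linear_le_sharp`),

hence `∫ J̃J̃·|w_⊥(θ)| ≤ π√3/(2(d+1))` for every `θ` (`integral_jweight_mul_abs_perp_le_sharp`, and the radial twin), by Cauchy–Schwarz in the
AM–GM form `|ℓ| ≤ λ/2 + ℓ²/(2λ)` against the probability weight, the vanishing mixed moment `∫ J̃J̃·st = 0` (odd × even) and the sharp second moment
`∫ s²J̃_d ≤ 3π²/(4(d+1)²)` (`…JacksonSharpMoments`).  At the flow degree `d = klFlowDeg n = 2⁷·4ⁿ`: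
`4ⁿ·∫ J̃J̃·|w_⊥| ≤ π√3/2⁸ = 0.02126…` (`four_pow_mul_transport_moment_klFlowDeg_le`) — `n`-FREE; divided by the minimal Fermi radius this is the
memo's coupling `κ = (π√3/2)/(2⁷·u_min)`.

Pure real analysis of the Jackson weight; nothing about the Hubbard model.
-/

noncomputable section

namespace Summit.HubbardSuperconductivity.HubbardSuperconductivity.Theorems.KLRegimeSplit

set_option linter.dupNamespace false -- summit = problem name (single-conjunct summit), D-0017

open Real MeasureTheory Literature.MathematicalPhysics.QuantumLattice Literature.Probability.LatticeModels

section Weight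

variable (d : ℕ)

/-- `∫ J̃(s)J̃(t)·(s·t) dμ = 0` (each factor has vanishing first moment). -/
theorem integral_jweight_mul_fst_mul_snd : ∫ w, jweight d w * (w.1 * w.2) ∂jmeas = 0 := by
  have hππ : -π ≤ π := by linarith [Real.pi_pos]
  have e : (fun w : ℝ × ℝ => jweight d w * (w.1 * w.2)) = fun w => (w.1 * jker d w.1) * (w.2 * jker d w.2) := by
    funext w; simp only [jweight]; ring
  rw [e, MeasureTheory.integral_prod_mul (μ := volume.restrict (Set.Ioc (-π) π)) (ν := volume.restrict (Set.Ioc (-π) π))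
    (f := fun s => s * jker d s) (g := fun t => t * jker d t)]
  rw [← intervalIntegral.integral_of_le hππ (f := fun s => s * jker d s), integral_mul_jker_eq_zero, zero_mul]

/-- `∫ J̃J̃·s² dμ ≤ 3π²/(4(d+1)²)` (sharp second moment of the first coordinate). -/
theorem integral_jweight_mul_fst_sq_le_sharp : ∫ w, jweight d w * w.1 ^ 2 ∂jmeas ≤ 3 * π ^ 2 / (4 * ((d : ℝ) + 1) ^ 2) := by
  have hππ : -π ≤ π := by linarith [Real.pi_pos]
  have e : (fun w : ℝ × ℝ => jweight d w * w.1 ^ 2) = fun w => (w.1 ^ 2 * jker d w.1) * jker d w.2 := by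
    funext w; simp only [jweight]; ring
  rw [e, MeasureTheory.integral_prod_mul (μ := volume.restrict (Set.Ioc (-π) π)) (ν := volume.restrict (Set.Ioc (-π) π))
    (f := fun s => s ^ 2 * jker d s) (g := fun t => jker d t)]
  rw [← intervalIntegral.integral_of_le hππ (f := fun s => s ^ 2 * jker d s), ← intervalIntegral.integral_of_le hππ (f := fun t => jker d t),
    integral_jker, mul_one]
  exact integral_sq_mul_jker_le_sharp' d

/-- `∫ J̃J̃·t² dμ ≤ 3π²/(4(d+1)²)` (sharp second moment of the second coordinate). -/
theorem integral_jweight_mul_snd_sq_le_sharp : ∫ w, jweight d w * w.2 ^ 2 ∂jmeas ≤ 3 * π ^ 2 / (4 * ((d : ℝ) + 1) ^ 2) := by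
  have hππ : -π ≤ π := by linarith [Real.pi_pos]
  have e : (fun w : ℝ × ℝ => jweight d w * w.2 ^ 2) = fun w => jker d w.1 * (w.2 ^ 2 * jker d w.2) := by
    funext w; simp only [jweight]; ring
  rw [e, MeasureTheory.integral_prod_mul (μ := volume.restrict (Set.Ioc (-π) π)) (ν := volume.restrict (Set.Ioc (-π) π))
    (f := fun s => jker d s) (g := fun t => t ^ 2 * jker d t)]
  rw [← intervalIntegral.integral_of_le hππ (f := fun s => jker d s), ← intervalIntegral.integral_of_le hππ (f := fun t => t ^ 2 * jker d t),
    integral_jker, one_mul]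
  exact integral_sq_mul_jker_le_sharp' d

/-- **Second moment of a linear form**: `∫ J̃J̃·(a·s + b·t)² dμ ≤ (a² + b²)·3π²/(4(d+1)²)` (the mixed moment vanishes). -/
theorem integral_jweight_mul_sq_linear_le_sharp (a b : ℝ) :
    ∫ w, jweight d w * (a * w.1 + b * w.2) ^ 2 ∂jmeas ≤ (a ^ 2 + b ^ 2) * (3 * π ^ 2 / (4 * ((d : ℝ) + 1) ^ 2)) := by
  have hj : Continuous (jweight d) := continuous_jweight d
  have i1 : Integrable (fun w : ℝ × ℝ => jweight d w * w.1 ^ 2) jmeas := integrable_jmeas_of_continuous (hj.mul (continuous_fst.pow 2))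
  have i2 : Integrable (fun w : ℝ × ℝ => jweight d w * w.2 ^ 2) jmeas := integrable_jmeas_of_continuous (hj.mul (continuous_snd.pow 2))
  have i3 : Integrable (fun w : ℝ × ℝ => jweight d w * (w.1 * w.2)) jmeas :=
    integrable_jmeas_of_continuous (hj.mul (continuous_fst.mul continuous_snd))
  have e : (fun w : ℝ × ℝ => jweight d w * (a * w.1 + b * w.2) ^ 2) = fun w =>
      a ^ 2 * (jweight d w * w.1 ^ 2) + b ^ 2 * (jweight d w * w.2 ^ 2) + (2 * a * b) * (jweight d w * (w.1 * w.2)) := by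
    funext w; ring
  have i12 : Integrable (fun w : ℝ × ℝ => a ^ 2 * (jweight d w * w.1 ^ 2) + b ^ 2 * (jweight d w * w.2 ^ 2)) jmeas :=
    (i1.const_mul _).add (i2.const_mul _)
  rw [e, integral_add i12 (i3.const_mul _), integral_add (i1.const_mul _) (i2.const_mul _),
    integral_const_mul, integral_const_mul, integral_const_mul, integral_jweight_mul_fst_mul_snd, mul_zero, add_zero]
  have h1 := integral_jweight_mul_fst_sq_le_sharp d
  have h2 := integral_jweight_mul_snd_sq_le_sharp d
  have ha : 0 ≤ a ^ 2 := sq_nonneg a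
  have hb : 0 ≤ b ^ 2 := sq_nonneg b
  nlinarith [mul_le_mul_of_nonneg_left h1 ha, mul_le_mul_of_nonneg_left h2 hb]

/-- **Transport moment, sharp and isotropic**: `∫ J̃J̃·|a·s + b·t| dμ ≤ √(a² + b²)·π√3/(2(d+1))` — Cauchy–Schwarz against the probability weight
in the AM–GM form `|ℓ| ≤ λ/2 + ℓ²/(2λ)` with `λ = √(a²+b²)·π√3/(2(d+1))`. -/
theorem integral_jweight_mul_abs_linear_le_sharp (a b : ℝ) :
    ∫ w, jweight d w * |a * w.1 + b * w.2| ∂jmeas ≤ Real.sqrt (a ^ 2 + b ^ 2) * (π * Real.sqrt 3 / (2 * ((d : ℝ) + 1))) := by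
  have hj : Continuous (jweight d) := continuous_jweight d
  have hd : (0 : ℝ) < (d : ℝ) + 1 := by positivity
  set σ : ℝ := π * Real.sqrt 3 / (2 * ((d : ℝ) + 1)) with hσ
  have hσpos : 0 < σ := by rw [hσ]; positivity
  have hσsq : σ ^ 2 = 3 * π ^ 2 / (4 * ((d : ℝ) + 1) ^ 2) := by
    rw [hσ, div_pow, mul_pow, Real.sq_sqrt (by norm_num)]; ring
  set ρ : ℝ := Real.sqrt (a ^ 2 + b ^ 2) with hρ
  have hρ0 : 0 ≤ ρ := Real.sqrt_nonneg _
  have hρsq : ρ ^ 2 = a ^ 2 + b ^ 2 := Real.sq_sqrt (by positivity)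
  by_cases hab : a ^ 2 + b ^ 2 = 0
  · -- degenerate direction: the integrand vanishes
    have ha : a = 0 := by nlinarith [sq_nonneg a, sq_nonneg b]
    have hb : b = 0 := by nlinarith [sq_nonneg a, sq_nonneg b]
    simp [ha, hb, hρ]
  have hρpos : 0 < ρ := by
    rw [hρ]; exact Real.sqrt_pos.mpr (lt_of_le_of_ne (by positivity) (Ne.symm hab))
  set lam : ℝ := ρ * σ with hlam
  have hlam0 : 0 < lam := mul_pos hρpos hσpos
  -- pointwise AM–GM: |ℓ| ≤ λ/2 + ℓ²/(2λ)
  have hpt : ∀ w : ℝ × ℝ, jweight d w * |a * w.1 + b * w.2| ≤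
      jweight d w * (lam / 2) + (1 / (2 * lam)) * (jweight d w * (a * w.1 + b * w.2) ^ 2) := by
    intro w
    have hJ : 0 ≤ jweight d w := mul_nonneg (jker_nonneg d w.1) (jker_nonneg d w.2)
    have hamgm : |a * w.1 + b * w.2| ≤ lam / 2 + (a * w.1 + b * w.2) ^ 2 / (2 * lam) := by
      have hsq : (|a * w.1 + b * w.2| - lam) ^ 2 ≥ 0 := sq_nonneg _
      have habs : |a * w.1 + b * w.2| ^ 2 = (a * w.1 + b * w.2) ^ 2 := sq_abs _
      rw [ge_iff_le, sub_sq, habs] at hsq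
      rw [div_add_div _ _ (by norm_num : (2 : ℝ) ≠ 0) (by positivity : (2 : ℝ) * lam ≠ 0), le_div_iff₀ (by positivity)]
      nlinarith
    calc jweight d w * |a * w.1 + b * w.2| ≤ jweight d w * (lam / 2 + (a * w.1 + b * w.2) ^ 2 / (2 * lam)) :=
          mul_le_mul_of_nonneg_left hamgm hJ
      _ = jweight d w * (lam / 2) + (1 / (2 * lam)) * (jweight d w * (a * w.1 + b * w.2) ^ 2) := by ring
  have iL : Integrable (fun w : ℝ × ℝ => jweight d w * |a * w.1 + b * w.2|) jmeas :=
    integrable_jmeas_of_continuous (hj.mul ((continuous_const.mul continuous_fst).add (continuous_const.mul continuous_snd)).abs)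
  have iA : Integrable (fun w : ℝ × ℝ => jweight d w * (lam / 2)) jmeas := integrable_jmeas_of_continuous (hj.mul continuous_const)
  have iB : Integrable (fun w : ℝ × ℝ => jweight d w * (a * w.1 + b * w.2) ^ 2) jmeas :=
    integrable_jmeas_of_continuous (hj.mul (((continuous_const.mul continuous_fst).add (continuous_const.mul continuous_snd)).pow 2))
  have iR : Integrable (fun w : ℝ × ℝ => jweight d w * (lam / 2) + (1 / (2 * lam)) * (jweight d w * (a * w.1 + b * w.2) ^ 2)) jmeas :=
    iA.add (iB.const_mul _)
  have hmono := integral_mono iL iR hpt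
  rw [integral_add iA (iB.const_mul _), integral_const_mul, integral_mul_const, integral_jweight, one_mul] at hmono
  have hB := integral_jweight_mul_sq_linear_le_sharp d a b
  rw [← hσsq, ← hρsq] at hB
  -- λ/2 + ρ²σ²/(2λ) = ρσ
  have hfin : lam / 2 + 1 / (2 * lam) * (ρ ^ 2 * σ ^ 2) = ρ * σ := by
    rw [hlam]; field_simp; ring
  calc ∫ w, jweight d w * |a * w.1 + b * w.2| ∂jmeas
      ≤ lam / 2 + 1 / (2 * lam) * ∫ w, jweight d w * (a * w.1 + b * w.2) ^ 2 ∂jmeas := hmono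
    _ ≤ lam / 2 + 1 / (2 * lam) * (ρ ^ 2 * σ ^ 2) := by gcongr
    _ = ρ * σ := hfin

/-- **The perpendicular transport moment**: `∫ J̃J̃·|−sin θ·s + cos θ·t| dμ ≤ π√3/(2(d+1))`, uniformly in the direction `θ`. -/
theorem integral_jweight_mul_abs_perp_le_sharp (θ : ℝ) :
    ∫ w, jweight d w * |-Real.sin θ * w.1 + Real.cos θ * w.2| ∂jmeas ≤ π * Real.sqrt 3 / (2 * ((d : ℝ) + 1)) := by
  have h := integral_jweight_mul_abs_linear_le_sharp d (-Real.sin θ) (Real.cos θ)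
  rwa [neg_sq, Real.sin_sq_add_cos_sq, Real.sqrt_one, one_mul] at h

/-- The radial twin: `∫ J̃J̃·|cos θ·s + sin θ·t| dμ ≤ π√3/(2(d+1))`. -/
theorem integral_jweight_mul_abs_radial_le_sharp (θ : ℝ) :
    ∫ w, jweight d w * |Real.cos θ * w.1 + Real.sin θ * w.2| ∂jmeas ≤ π * Real.sqrt 3 / (2 * ((d : ℝ) + 1)) := by
  have h := integral_jweight_mul_abs_linear_le_sharp d (Real.cos θ) (Real.sin θ)
  rwa [Real.cos_sq_add_sin_sq, Real.sqrt_one, one_mul] at h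

end Weight

/-! ## At the flow degree `d = klFlowDeg n = 2⁷·4ⁿ`: the `n`-free coupling -/

/-- `π√3/(2(klFlowDeg n + 1)) ≤ (π√3/2⁸)·(1/4)ⁿ`. -/
theorem transport_sigma_klFlowDeg_le (n : ℕ) :
    π * Real.sqrt 3 / (2 * (((klFlowDeg n : ℕ) : ℝ) + 1)) ≤ π * Real.sqrt 3 / 2 ^ 8 * (1 / 4) ^ n := by
  rw [klFlowDeg_cast]
  have h4 : (0 : ℝ) < 4 ^ n := by positivity
  have hnum : 0 ≤ π * Real.sqrt 3 := by positivity
  rw [one_div_pow, div_mul_eq_mul_div, mul_one_div, div_div]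
  exact div_le_div_of_nonneg_left hnum (by positivity) (by nlinarith)

/-- **`4ⁿ·∫ J̃_{d_n}J̃_{d_n}·|w_⊥(θ)| dμ ≤ π√3/2⁸`** (`≈ 0.02126`), `d_n = klFlowDeg n`, every `n` and every direction — the `n`-FREE transport coupling
of the memo (`κ·u_min`). -/
theorem four_pow_mul_transport_moment_klFlowDeg_le (n : ℕ) (θ : ℝ) :
    (4 : ℝ) ^ n * ∫ w, jweight (klFlowDeg n) w * |-Real.sin θ * w.1 + Real.cos θ * w.2| ∂jmeas ≤ π * Real.sqrt 3 / 2 ^ 8 := by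
  have h := (integral_jweight_mul_abs_perp_le_sharp (klFlowDeg n) θ).trans (transport_sigma_klFlowDeg_le n)
  have h4 : (0 : ℝ) < 4 ^ n := by positivity
  have e : (4 : ℝ) ^ n * (π * Real.sqrt 3 / 2 ^ 8 * (1 / 4) ^ n) = π * Real.sqrt 3 / 2 ^ 8 := by
    rw [one_div_pow]; field_simp
  calc (4 : ℝ) ^ n * ∫ w, jweight (klFlowDeg n) w * |-Real.sin θ * w.1 + Real.cos θ * w.2| ∂jmeas
      ≤ (4 : ℝ) ^ n * (π * Real.sqrt 3 / 2 ^ 8 * (1 / 4) ^ n) := mul_le_mul_of_nonneg_left h h4.le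
    _ = π * Real.sqrt 3 / 2 ^ 8 := e

/-- Numeric form: `π√3/2⁸ < 0.0213`. -/
theorem transport_coupling_lt : π * Real.sqrt 3 / (2 : ℝ) ^ 8 < 0.0213 := by
  have hπ : π < 3.1416 := Real.pi_lt_d4
  have h3 : Real.sqrt 3 < 1.7321 := by
    rw [Real.sqrt_lt' (by norm_num)]; norm_num
  have h0 : 0 < Real.sqrt 3 := Real.sqrt_pos.mpr (by norm_num)
  have : π * Real.sqrt 3 < 3.1416 * 1.7321 := by nlinarith [Real.pi_pos]
  rw [div_lt_iff₀ (by positivity)]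
  nlinarith

end Summit.HubbardSuperconductivity.HubbardSuperconductivity.Theorems.KLRegimeSplit

end
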